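import Literature.NumberTheory.Automorphic.ReductiveDualBruhat
import Literature.NumberTheory.Automorphic.RankOneOrbitBruhat
import Literature.NumberTheory.Automorphic.BorelConjugacy
import HarnessLib

/-!
# The Bruhat decomposition in semisimple rank one, discharged; assembly of `exists_isRootDatumOf`
(trunk T-AUTOMORPHIC, G25 AutomorphicL; lang.S13 (b), Springer 7.2.2 (i), 7.4.3)

The named fact `bruhat_rankOne_of_central` (`ReductiveDualBruhat.lean`, Springer 7.2.2 (i)) is
**proved** from the Borel-subgroup facts: `atMostTwo_isBorelIn_of_central` and
`exists_rootHom_sup_isBorelIn_of_central` (7.3.3 (ii): `T · U_α` is a Borel subgroup),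
`centralizer_eq_of_isMaximalTorusIn` (7.6.4 (ii): `Z_G(T) = T`) and
`isClosed_orbitCone_of_borel_le_lineStabilizer` (6.2.7 (ii): orbits of lines fixed by a Borel
subgroup are closed), through the `k`-points analysis of `G/B ≅ ℙ¹` in `RankOneOrbit*.lean`
(`bruhat_of_isBorelIn`). Consequently the existence of the root datum of a connected reductive
group (`exists_isRootDatumOf`, Springer 7.4.3) follows from the facts
`isConnectedReductive_centralizer_torus` (7.6.4 (i)), `isBorelIn_conj` (6.2.7 (iii)),
`centralizer_eq_of_isMaximalTorusIn` (7.6.4 (ii)), `exists_rootHom_sup_isBorelIn_of_central`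
(7.3.3 (ii)) and `isClosed_orbitCone_of_borel_le_lineStabilizer` (6.2.7 (ii)):
`exists_isRootDatumOf_of_orbitClosed`; and, feeding the tree's discharge `isBorelIn_conj_holds`
(`BorelConjugacy.lean`), from the four facts A, D, E, F_orb alone:
`exists_isRootDatumOf_of_structureFacts`.

## References

* [SpringerLAG1998] T. A. Springer, *Linear Algebraic Groups*, 2nd ed. (1998): 6.2.7, 7.2.2, 7.3.3,
  7.4.3, 7.6.4.
-/

open scoped MatrixGroups

namespace Literature.NumberTheory.Automorphic

variable {k : Type*} [Field k] {n : Type*} [Fintype n] [DecidableEq n]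

/-- **`bruhat_rankOne_of_central` holds given the Borel-subgroup facts** (Springer 7.2.2 (i),
proved on `k`-points in `RankOneOrbitBruhat.bruhat_of_isBorelIn`; `T · U_α` is a Borel subgroup
by 7.3.3 (ii) and the uniqueness of root subgroups `IsRootHom.map_range_eq_of_central`).
[cite: SpringerLAG1998, 7.2.2 (i)] -/
theorem bruhat_rankOne_of_central_of_facts
    (hC₁ : atMostTwo_isBorelIn_of_central (k := k) (n := n))
    (hC₂ : exists_rootHom_sup_isBorelIn_of_central (k := k) (n := n))
    (hF₃ : centralizer_eq_of_isMaximalTorusIn (k := k) (n := n))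
    (hOrb : isClosed_orbitCone_of_borel_le_lineStabilizer (k := k) (n := n)) :
    bruhat_rankOne_of_central (k := k) (n := n) := by
  intro _ G T hG hT α hα hcen u hu m hmG hmN hmZ g hg hgB
  obtain ⟨u', -, hu', -, hB', -, -⟩ := exists_rootHom_pair_isBorelIn_of_central hC₁ hC₂ hG hT hα hcen
  have hEq : u.range.map G.subtype = u'.range.map G.subtype :=
    hu.map_range_eq_of_central hC₁ hC₂ hG hT hα hcen hu'
  have hB : IsBorelIn (T ⊔ u.range.map G.subtype) G := by rw [hEq]; exact hB'
  exact bruhat_of_isBorelIn hF₃ hOrb hG hT hα hcen hu hB hmG hmN hmZ hg hgB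

/-- **The Bruhat fact is discharged relative to the Borel-subgroup facts** (pointwise form).
[cite: SpringerLAG1998, 7.2.2 (i)] -/
theorem bruhat_rankOne_of_central_holds_of
    (hF₁ : isBorelIn_conj (k := k) (n := n))
    (hF₃ : centralizer_eq_of_isMaximalTorusIn (k := k) (n := n))
    (hC₂ : exists_rootHom_sup_isBorelIn_of_central (k := k) (n := n))
    (hOrb : isClosed_orbitCone_of_borel_le_lineStabilizer (k := k) (n := n)) :
    bruhat_rankOne_of_central (k := k) (n := n) :=
  bruhat_rankOne_of_central_of_facts
    (atMostTwo_isBorelIn_of_central_of_facts hF₁ isMaximalTorusIn_conj_of_isSolvable_holds hF₃)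
    hC₂ hF₃ hOrb

variable {G T : Subgroup (GL n k)}

/-- **Existence of the root datum of a connected reductive group (Springer 7.4.3), from the
Borel-subgroup facts only**: `isConnectedReductive_centralizer_torus` (7.6.4 (i)),
`isBorelIn_conj` (6.2.7 (iii)), `centralizer_eq_of_isMaximalTorusIn` (7.6.4 (ii)),
`exists_rootHom_sup_isBorelIn_of_central` (7.3.3 (ii)) and
`isClosed_orbitCone_of_borel_le_lineStabilizer` (6.2.7 (ii)); everything else — integrality of
the pairing, the reflections `s_α` (7.1.8), the rank-one relations (7.2.4) via the Bruhat
decomposition (7.2.2), finiteness and reducedness of the roots, the root-datum axioms (7.4.3) —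
is proved in the tree. [cite: SpringerLAG1998, 7.4.3] -/
theorem exists_isRootDatumOf_of_orbitClosed
    (hA : isConnectedReductive_centralizer_torus (k := k) (n := n))
    (hF₁ : isBorelIn_conj (k := k) (n := n))
    (hF₃ : centralizer_eq_of_isMaximalTorusIn (k := k) (n := n))
    (hC₂ : exists_rootHom_sup_isBorelIn_of_central (k := k) (n := n))
    (hOrb : isClosed_orbitCone_of_borel_le_lineStabilizer (k := k) (n := n)) :
    exists_isRootDatumOf (G := G) (T := T) :=
  exists_isRootDatumOf_of_bruhat hA hF₁ hF₃ hC₂ (bruhat_rankOne_of_central_holds_of hF₁ hF₃ hC₂ hOrb)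


/-- **Existence of the root datum (Springer 7.4.3) from four structure-theory facts**: with the
conjugacy of Borel subgroups discharged in the tree (`isBorelIn_conj_holds`, `BorelConjugacy.lean`),
`exists_isRootDatumOf` follows from `isConnectedReductive_centralizer_torus` (7.6.4 (i)),
`centralizer_eq_of_isMaximalTorusIn` (7.6.4 (ii)), `exists_rootHom_sup_isBorelIn_of_central`
(7.3.3 (ii)) and `isClosed_orbitCone_of_borel_le_lineStabilizer` (6.2.7 (ii)).
[cite: SpringerLAG1998, 7.4.3] -/
theorem exists_isRootDatumOf_of_structureFacts
    (hA : isConnectedReductive_centralizer_torus (k := k) (n := n))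
    (hF₃ : centralizer_eq_of_isMaximalTorusIn (k := k) (n := n))
    (hC₂ : exists_rootHom_sup_isBorelIn_of_central (k := k) (n := n))
    (hOrb : isClosed_orbitCone_of_borel_le_lineStabilizer (k := k) (n := n)) :
    exists_isRootDatumOf (G := G) (T := T) :=
  exists_isRootDatumOf_of_orbitClosed hA isBorelIn_conj_holds hF₃ hC₂ hOrb

end Literature.NumberTheory.Automorphic
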